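import Mathlib.FieldTheory.IsAlgClosed.Basic
import Literature.AlgebraicGeometry.Resolution.AffineDomainEquidim
import Summits.ResolutionOfSingularities.ResolutionOfSingularities.Theorems.FrobeniusLadderFInjectiveMacaulayficationChartPointParameters
import Summits.ResolutionOfSingularities.ResolutionOfSingularities.Theorems.FrobeniusLadderFInjectiveMacaulayficationHypersurfaceRegular
import HarnessLib

/-!
# The local ring of a hypersurface chart at a rational point, as an abstract localization: the facts the pencil recipes consume
# (BED Ω₁ GLOBAL PATCH, F6 v2 §4 «F6b concrete bridge»: `B = 𝒪_{X̃₂,x̃}` is a localization of `k[y]/(θ_c)` at the maximal ideal of the `k`-point `c`; this file delivers, for ANY such `B`: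
# the map `φ : k[y] → B` with `φ θ = 0`, `𝔭_c·B = 𝔪_B`; Noetherianity; regularity and `dim B = n − 1` from `∂θ/∂y_l(c) ≠ 0`; the residue field is `k`;
# crux `FInjectiveMacaulayfication` stmt-ResolutionOfSingularities-15315, chain w45a; seat res-L1-w45a-stub-3 g15)

[OURS · L1 W4.5a] Support file (`--supports stmt-ResolutionOfSingularities-15315 --as helper`); theorems only; GENERIC (any field, any `θ`); no named fact; NOT a statement of any manuscript;
nothing of the crux is proved. AI-written (AI review is weaker than expert review).
* `map_theta`, `map_pointIdeal_eq_maximalIdeal`, `isNoetherianRing` — the hypotheses of ✓ `ChartPointParameters` §3 for `φ = (algebraMap (k[y]/(θ)) B) ∘ mk`;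
* ★ `isRegularLocalRing_of_pderiv` and ★ `ringKrullDim_eq` (`dim B = n − 1`) — through the clean model `k[y]_{𝔭_c}/(θ)` (✓ `HypersurfaceRegular`, ✓ `MvPolynomial.height_eq_of_isMaximal`, the
  non-zero-divisor `θ`), which is a localization of `k[y]/(θ)` at the point as well (✓ `QuotLocalizationIso.algebraMapSubmonoid_primeCompl_comap`); `length_erase_eq_ringKrullDim`;
* ★ `residue_comp_bijective` — `k → B/𝔪_B` is bijective (every residue is the value at `c` of a fraction), so the residue field is algebraically closed when `k` is (`isAlgClosed_residueField`).
[cite: Matsumura1987, Thm. 14.2, §5 Ex. 5.1; Hartshorne1977, I Thm. 5.1]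
-/

set_option linter.dupNamespace false

noncomputable section

namespace Summit.ResolutionOfSingularities.ResolutionOfSingularities.Theorems.FInjectiveMacaulayfication.ChartPointLocalRing

open IsLocalRing MvPolynomial Literature.AlgebraicGeometry.Resolution
open Summit.ResolutionOfSingularities.ResolutionOfSingularities.Theorems.FInjectiveMacaulayfication

variable {k : Type} [Field k] {n : ℕ} (θ : MvPolynomial (Fin n) k) (c : Fin n → k)
  (Q : Ideal (MvPolynomial (Fin n) k ⧸ Ideal.span {θ})) [Q.IsPrime]
  (hQ : Q.comap (Ideal.Quotient.mk (Ideal.span {θ})) = Ideal.span (Set.range fun i : Fin n => (X i : MvPolynomial (Fin n) k) - C (c i)))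

/-! ## §1 The point -/

/-- The point ideal `𝔭_c` is maximal. [folklore] -/
theorem isMaximal_pointIdeal : (Ideal.span (Set.range fun i : Fin n => (X i : MvPolynomial (Fin n) k) - C (c i))).IsMaximal := by
  have hker : Ideal.span (Set.range fun i : Fin n => (X i : MvPolynomial (Fin n) k) - C (c i)) = RingHom.ker (eval c) := by
    ext g; rw [RingHom.mem_ker]; exact ChartPointParameters.eval_mem_pointIdeal_iff c g
  rw [hker]
  exact RingHom.ker_isMaximal_of_surjective _ fun a => ⟨C a, eval_C a⟩

include hQ in
omit [Q.IsPrime] in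
/-- `θ(c) = 0`. [plumbing] -/
theorem eval_theta_eq_zero : eval c θ = 0 := by
  have h : θ ∈ Q.comap (Ideal.Quotient.mk (Ideal.span {θ})) := by
    rw [Ideal.mem_comap, Ideal.Quotient.eq_zero_iff_mem.mpr (Ideal.mem_span_singleton_self θ)]; exact Q.zero_mem
  rw [hQ] at h
  exact (ChartPointParameters.eval_mem_pointIdeal_iff c θ).mp h

variable (B : Type) [CommRing B] [Algebra (MvPolynomial (Fin n) k ⧸ Ideal.span {θ}) B] [IsLocalization.AtPrime B Q]

/-! ## §2 The map `φ : k[y] → B` -/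

/-- `φ θ = 0`. [plumbing] -/
theorem map_theta : ((algebraMap _ B).comp (Ideal.Quotient.mk (Ideal.span {θ}))) θ = 0 := by
  rw [RingHom.comp_apply, Ideal.Quotient.eq_zero_iff_mem.mpr (Ideal.mem_span_singleton_self θ), map_zero]

include Q in
/-- `B` is Noetherian. [folklore] -/
theorem isNoetherianRing : IsNoetherianRing B := IsLocalization.isNoetherianRing Q.primeCompl B inferInstance

variable [IsLocalRing B]

include hQ in
/-- `𝔭_c·B = 𝔪_B`. [folklore] -/
theorem map_pointIdeal_eq_maximalIdeal :
    (Ideal.span (Set.range fun i : Fin n => (X i : MvPolynomial (Fin n) k) - C (c i))).map ((algebraMap _ B).comp (Ideal.Quotient.mk (Ideal.span {θ}))) =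
      maximalIdeal B := by
  rw [← Ideal.map_map, ← hQ, Ideal.map_comap_of_surjective _ Ideal.Quotient.mk_surjective, IsLocalization.AtPrime.map_eq_maximalIdeal Q B]

/-! ## §3 Regularity and dimension through the clean model `k[y]_{𝔭_c}/(θ)` -/

/-- The model `k[y]_{𝔭_c}/(θ)` is a localization of `k[y]/(θ)` at the point. [folklore; cite: StacksProject, Tag 00CT] -/
theorem isLocalization_model :
    IsLocalization.AtPrime (Localization.AtPrime (Q.comap (Ideal.Quotient.mk (Ideal.span {θ}))) ⧸
      (Ideal.span {θ}).map (algebraMap _ (Localization.AtPrime (Q.comap (Ideal.Quotient.mk (Ideal.span {θ})))))) Q := by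
  have h : IsLocalization (Algebra.algebraMapSubmonoid (MvPolynomial (Fin n) k ⧸ Ideal.span {θ}) (Q.comap (Ideal.Quotient.mk (Ideal.span {θ}))).primeCompl)
      (Localization.AtPrime (Q.comap (Ideal.Quotient.mk (Ideal.span {θ}))) ⧸
        (Ideal.span {θ}).map (algebraMap _ (Localization.AtPrime (Q.comap (Ideal.Quotient.mk (Ideal.span {θ})))))) := inferInstance
  rwa [QuotLocalizationIso.algebraMapSubmonoid_primeCompl_comap (Ideal.span {θ}) Q] at h

omit [IsLocalRing B] in
/-- The ring isomorphism `k[y]_{𝔭_c}/(θ) ≃ B` (uniqueness of localizations). [folklore] -/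
theorem exists_model_ringEquiv :
    Nonempty ((Localization.AtPrime (Q.comap (Ideal.Quotient.mk (Ideal.span {θ}))) ⧸
      Ideal.span {algebraMap _ (Localization.AtPrime (Q.comap (Ideal.Quotient.mk (Ideal.span {θ})))) θ}) ≃+* B) := by
  haveI := isLocalization_model θ Q
  have heq : Ideal.span {algebraMap _ (Localization.AtPrime (Q.comap (Ideal.Quotient.mk (Ideal.span {θ})))) θ} =
      (Ideal.span {θ}).map (algebraMap _ (Localization.AtPrime (Q.comap (Ideal.Quotient.mk (Ideal.span {θ}))))) := by
    rw [Ideal.map_span, Set.image_singleton]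
  exact ⟨(Ideal.quotEquivOfEq heq).trans
    (IsLocalization.algEquiv Q.primeCompl (Localization.AtPrime (Q.comap (Ideal.Quotient.mk (Ideal.span {θ}))) ⧸
      (Ideal.span {θ}).map (algebraMap _ (Localization.AtPrime (Q.comap (Ideal.Quotient.mk (Ideal.span {θ})))))) B).toRingEquiv⟩

include hQ in
omit [IsLocalRing B] in
/-- ★ `B` is a regular local ring as soon as `∂θ/∂y_l(c) ≠ 0` for some `l`. [cite: Matsumura1987, Thm. 30.4 (ii); Hartshorne1977, I Thm. 5.1] -/
theorem isRegularLocalRing_of_pderiv (l : Fin n) (hl : eval c (pderiv l θ) ≠ 0) : IsRegularLocalRing B := by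
  have hθP : θ ∈ Q.comap (Ideal.Quotient.mk (Ideal.span {θ})) := by
    rw [Ideal.mem_comap, Ideal.Quotient.eq_zero_iff_mem.mpr (Ideal.mem_span_singleton_self θ)]; exact Q.zero_mem
  have hd : pderiv l θ ∉ Q.comap (Ideal.Quotient.mk (Ideal.span {θ})) := by
    rw [hQ, ChartPointParameters.eval_mem_pointIdeal_iff]; exact hl
  haveI := HypersurfaceRegular.isRegularLocalRing_localization_quotient_of_pderiv_not_mem k n θ l _ hθP hd
  obtain ⟨e⟩ := exists_model_ringEquiv θ Q B
  exact IsRegularLocalRing.of_ringEquiv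
    (R := Localization.AtPrime (Q.comap (Ideal.Quotient.mk (Ideal.span {θ}))) ⧸
      Ideal.span {algebraMap _ (Localization.AtPrime (Q.comap (Ideal.Quotient.mk (Ideal.span {θ})))) θ}) e

include hQ in
omit [IsLocalRing B] in
/-- ★ **`dim B = n − 1`** (`n ≥ 1`, `θ ≠ 0`). [cite: Matsumura1987, §5 Ex. 5.1, Thm. 17.4] -/
theorem ringKrullDim_eq (hn : 1 ≤ n) (hθ0 : θ ≠ 0) : ringKrullDim B = ((n - 1 : ℕ) : WithBot ℕ∞) := by
  haveI hPmax : (Q.comap (Ideal.Quotient.mk (Ideal.span {θ}))).IsMaximal := by rw [hQ]; exact isMaximal_pointIdeal c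
  -- `dim k[y]_P = n`
  have hdimP : ringKrullDim (Localization.AtPrime (Q.comap (Ideal.Quotient.mk (Ideal.span {θ})))) = (n : WithBot ℕ∞) := by
    rw [IsLocalization.AtPrime.ringKrullDim_eq_height (Q.comap (Ideal.Quotient.mk (Ideal.span {θ}))) (Localization.AtPrime (Q.comap (Ideal.Quotient.mk (Ideal.span {θ})))),
      MvPolynomial.height_eq_of_isMaximal k n]
    rfl
  -- cut by the non-zero-divisor `θ/1 ∈ 𝔪`
  have hθP : θ ∈ Q.comap (Ideal.Quotient.mk (Ideal.span {θ})) := by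
    rw [Ideal.mem_comap, Ideal.Quotient.eq_zero_iff_mem.mpr (Ideal.mem_span_singleton_self θ)]; exact Q.zero_mem
  have hmem : algebraMap _ (Localization.AtPrime (Q.comap (Ideal.Quotient.mk (Ideal.span {θ})))) θ ∈
      maximalIdeal (Localization.AtPrime (Q.comap (Ideal.Quotient.mk (Ideal.span {θ})))) := by
    rw [← Localization.AtPrime.map_eq_maximalIdeal]; exact Ideal.mem_map_of_mem _ hθP
  have hnzd : algebraMap _ (Localization.AtPrime (Q.comap (Ideal.Quotient.mk (Ideal.span {θ})))) θ ∈
      nonZeroDivisors (Localization.AtPrime (Q.comap (Ideal.Quotient.mk (Ideal.span {θ})))) :=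
    mem_nonZeroDivisors_of_ne_zero fun h0 => hθ0 (IsLocalization.injective (Localization.AtPrime (Q.comap (Ideal.Quotient.mk (Ideal.span {θ}))))
      (Q.comap (Ideal.Quotient.mk (Ideal.span {θ}))).primeCompl_le_nonZeroDivisors (by rw [h0, map_zero]))
  have hquot := ringKrullDim_quotient_span_singleton_succ_eq_ringKrullDim_of_mem_nonZeroDivisors hnzd hmem
  rw [hdimP] at hquot
  obtain ⟨e⟩ := exists_model_ringEquiv θ Q B
  rw [ringKrullDim_eq_of_ringEquiv e] at hquot
  have hn' : (n : WithBot ℕ∞) = ((n - 1 : ℕ) : WithBot ℕ∞) + 1 := by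
    conv_lhs => rw [show n = (n - 1) + 1 from (Nat.sub_add_cancel hn).symm]
    push_cast; rfl
  rw [hn'] at hquot
  exact ENat.WithBot.add_one_cancel.mp hquot

include hQ in
omit [IsLocalRing B] in
/-- The list of `n − 1` letters has the right length for the regular-system-of-parameters lemmas: `|((0..n).erase l)| = dim B`. [plumbing] -/
theorem length_erase_eq_ringKrullDim (hθ0 : θ ≠ 0) (l : Fin n) {α : Type} (z : Fin n → α) :
    ((((List.finRange n).erase l).map z).length : WithBot ℕ∞) = ringKrullDim B := by
  have hn : 1 ≤ n := Nat.one_le_iff_ne_zero.mpr fun h => by subst h; exact l.elim0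
  rw [ringKrullDim_eq θ c Q hQ B hn hθ0, List.length_map, List.length_erase_of_mem (List.mem_finRange l), List.length_finRange]

/-! ## §4 The residue field -/

include hQ in
/-- ★ **The residue field of `B` is `k`**: `k → B → B/𝔪_B` is bijective (every residue class is the value at `c` of a fraction `a/s`, `s(c) ≠ 0`). [folklore; cite: Hartshorne1977, I Thm. 3.2] -/
theorem residue_comp_bijective :
    Function.Bijective ((residue B).comp ((algebraMap _ B).comp ((Ideal.Quotient.mk (Ideal.span {θ})).comp (C : k →+* MvPolynomial (Fin n) k)))) := by
  set ι : k →+* ResidueField B := (residue B).comp ((algebraMap _ B).comp ((Ideal.Quotient.mk (Ideal.span {θ})).comp (C : k →+* MvPolynomial (Fin n) k))) with hι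
  -- values at `c`
  have hval : ∀ g : MvPolynomial (Fin n) k, residue B (algebraMap _ B (Ideal.Quotient.mk (Ideal.span {θ}) g)) = ι (eval c g) := by
    intro g
    have hdiff : g - C (eval c g) ∈ Q.comap (Ideal.Quotient.mk (Ideal.span {θ})) := by
      rw [hQ, ChartPointParameters.eval_mem_pointIdeal_iff, map_sub, eval_C, sub_self]
    have hm : algebraMap _ B (Ideal.Quotient.mk (Ideal.span {θ}) (g - C (eval c g))) ∈ maximalIdeal B := by
      rw [← IsLocalization.AtPrime.map_eq_maximalIdeal Q B]
      exact Ideal.mem_map_of_mem _ (Ideal.mem_comap.mp hdiff)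
    rw [map_sub, map_sub, ← residue_eq_zero_iff, map_sub, sub_eq_zero] at hm
    rw [hm, hι]; rfl
  refine ⟨ι.injective, fun ξ => ?_⟩
  obtain ⟨b, rfl⟩ := residue_surjective ξ
  obtain ⟨⟨a, s⟩, rfl⟩ := IsLocalization.mk'_surjective Q.primeCompl b
  obtain ⟨a₀, rfl⟩ := Ideal.Quotient.mk_surjective a
  obtain ⟨s₀, hs₀⟩ := Ideal.Quotient.mk_surjective (s : MvPolynomial (Fin n) k ⧸ Ideal.span {θ})
  have hs₀c : eval c s₀ ≠ 0 := by
    have hs₀Q : s₀ ∉ Q.comap (Ideal.Quotient.mk (Ideal.span {θ})) := by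
      rw [Ideal.mem_comap, hs₀]; exact s.2
    rwa [hQ, ChartPointParameters.eval_mem_pointIdeal_iff] at hs₀Q
  refine ⟨eval c a₀ / eval c s₀, ?_⟩
  -- `res(a/s) · ι(s(c)) = ι(a(c))`
  have key : residue B (IsLocalization.mk' B (Ideal.Quotient.mk (Ideal.span {θ}) a₀) s) * ι (eval c s₀) = ι (eval c a₀) := by
    rw [← hval, ← hval, hs₀, ← map_mul, IsLocalization.mk'_spec]
  have hι0 : ι (eval c s₀) ≠ 0 := (map_ne_zero ι).mpr hs₀c
  rw [map_div₀, div_eq_iff hι0]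
  exact key.symm

include hQ in
/-- ★ Hence the residue field of `B` is algebraically closed when `k` is. [folklore] -/
theorem isAlgClosed_residueField [IsAlgClosed k] : IsAlgClosed (ResidueField B) :=
  IsAlgClosed.of_ringEquiv k (ResidueField B) (RingEquiv.ofBijective _ (residue_comp_bijective θ c Q hQ B))

end Summit.ResolutionOfSingularities.ResolutionOfSingularities.Theorems.FInjectiveMacaulayfication.ChartPointLocalRing

end
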